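import Mathlib.Algebra.Polynomial.Splits
import Mathlib.Algebra.Polynomial.Div
import Mathlib.Algebra.Polynomial.AlgebraMap
import Mathlib.Algebra.BigOperators.Fin
import Mathlib.Analysis.Calculus.Deriv.Polynomial

/-!
# `NormalFormPrinciple` (stmt-KontsevichZagierPeriods-3869), stub `box_algsplit_mem_relations` —
# siege attempt k6 (explicit / elementary route), I: partial fractions over a field

Pure algebra, no definitions. For the stub `box_algsplit_mem_relations` (box-rational
representations `[(0,1), p/q]` whose denominator has only REAL ALGEBRAIC roots) we expand `p/q`
into partial fractions over the field `K = ℚ̄ ∩ ℝ` EXPLICITLY, by peeling one pole at a time: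

* `exists_peel_pole_field`: if `q(ρ) = 0` then `p/q = c/(t − ρ)^{k+1} + p₁/q₁` with `q₁` a proper
  divisor of `q` (one step, valid over any field `F`, the identity read in any field extension `L`);
* `exists_parfrac_field`: if `q ≠ 0` splits over `F` then
  `p/q = P(t) + Σᵢ cᵢ/(t − ρᵢ)^{kᵢ+1}` with `P ∈ F[X]`, finitely many triples `(ρᵢ, kᵢ, cᵢ)`,
  every `ρᵢ` a root of `q` (repetitions allowed; no uniqueness is claimed or needed);
* `exists_polynomial_primitive_field`: every `A ∈ F[X]` (`char F = 0`) has a primitive `G ∈ F[X]`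
  as a real function.

Sources: M. Kontsevich, D. Zagier, *Periods* (2001), §1.2 (the moves these feed); the algebra is
folklore (Euclid). No definitions are introduced.
-/

noncomputable section

open Finset
open scoped Polynomial

namespace Summit.KontsevichZagierPeriods.HurwitzMicroSectors.NormalFormPrinciple.PiBox.SiegeK6

/-! ## One peeling step -/

/-- **Peeling a pole over a field.** If `q(ρ) = 0` (`ρ ∈ F`, `q ≠ 0`) then, in every field
extension `L` of `F` and at every `t ∈ L` with `q(t) ≠ 0`,
`p(t)/q(t) = c/(t − ρ)^{k+1} + p₁(t)/q₁(t)`, where `k + 1` is the multiplicity of `ρ`,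
`q = (X − ρ)^{k+1} q₂`, `c = p(ρ)/q₂(ρ)`, `q₁ = (X − ρ)^k q₂` (a proper divisor of `q`) and
`p₁ = (p − c q₂)/(X − ρ)`. [folklore] -/
theorem exists_peel_pole_field {F L : Type*} [Field F] [Field L] [Algebra F L] (p q : F[X])
    (hq : q ≠ 0) {ρ : F} (hρ : q.IsRoot ρ) :
    ∃ (k : ℕ) (c : F) (p₁ q₁ : F[X]), q₁ ≠ 0 ∧ q₁.natDegree < q.natDegree ∧ q₁ ∣ q ∧
      ∀ t : L, Polynomial.aeval t q ≠ 0 →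
        Polynomial.aeval t p / Polynomial.aeval t q =
          algebraMap F L c / (t - algebraMap F L ρ) ^ (k + 1) +
            Polynomial.aeval t p₁ / Polynomial.aeval t q₁ := by
  -- adapted from `Dlog.exists_peel_pole` (…SplitAlgebra.lean), `ℚ` replaced by a field `F`
  obtain ⟨q₂, hq₂, hndvd⟩ := q.exists_eq_pow_rootMultiplicity_mul_and_not_dvd hq ρ
  have hm : 0 < q.rootMultiplicity ρ := (Polynomial.rootMultiplicity_pos hq).mpr hρ
  obtain ⟨k, hk⟩ : ∃ k, q.rootMultiplicity ρ = k + 1 := Nat.exists_eq_succ_of_ne_zero hm.ne'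
  have hq₂ρ : q₂.eval ρ ≠ 0 := fun h => hndvd (Polynomial.dvd_iff_isRoot.mpr h)
  have hq₂0 : q₂ ≠ 0 := by
    rintro rfl
    simp at hq₂ρ
  set c : F := p.eval ρ / q₂.eval ρ with hc
  have hroot : (p - Polynomial.C c * q₂).IsRoot ρ := by
    rw [Polynomial.IsRoot.def, Polynomial.eval_sub, Polynomial.eval_mul, Polynomial.eval_C, hc,
      div_mul_cancel₀ _ hq₂ρ, sub_self]
  set p₁ : F[X] := (p - Polynomial.C c * q₂) /ₘ (Polynomial.X - Polynomial.C ρ) with hp₁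
  have hp₁' : (Polynomial.X - Polynomial.C ρ) * p₁ = p - Polynomial.C c * q₂ :=
    Polynomial.mul_divByMonic_eq_iff_isRoot.mpr hroot
  set q₁ : F[X] := (Polynomial.X - Polynomial.C ρ) ^ k * q₂ with hq₁
  have hXne : (Polynomial.X - Polynomial.C ρ : F[X]) ≠ 0 := Polynomial.X_sub_C_ne_zero ρ
  refine ⟨k, c, p₁, q₁, mul_ne_zero (pow_ne_zero _ hXne) hq₂0, ?_, ?_, ?_⟩
  · have hdeg : q.natDegree = (k + 1) + q₂.natDegree := by
      conv_lhs => rw [hq₂, hk]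
      rw [Polynomial.natDegree_mul (pow_ne_zero _ hXne) hq₂0, Polynomial.natDegree_pow,
        Polynomial.natDegree_X_sub_C, mul_one]
    have hdeg₁ : q₁.natDegree = k + q₂.natDegree := by
      rw [hq₁, Polynomial.natDegree_mul (pow_ne_zero _ hXne) hq₂0, Polynomial.natDegree_pow,
        Polynomial.natDegree_X_sub_C, mul_one]
    omega
  · refine ⟨Polynomial.X - Polynomial.C ρ, ?_⟩
    conv_lhs => rw [hq₂, hk]
    rw [hq₁, pow_succ]
    ring
  · intro t ht
    have hqt : Polynomial.aeval t q = (t - algebraMap F L ρ) ^ (k + 1) * Polynomial.aeval t q₂ := by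
      conv_lhs => rw [hq₂, hk]
      simp [map_mul, map_pow]
    have hq₁t : Polynomial.aeval t q₁ = (t - algebraMap F L ρ) ^ k * Polynomial.aeval t q₂ := by
      rw [hq₁]
      simp [map_mul, map_pow]
    have hpt : Polynomial.aeval t p =
        (t - algebraMap F L ρ) * Polynomial.aeval t p₁ + algebraMap F L c * Polynomial.aeval t q₂ := by
      have h := congrArg (Polynomial.aeval t) hp₁'
      simp only [map_mul, map_sub, Polynomial.aeval_X, Polynomial.aeval_C] at h
      linear_combination -h
    have htρ : t - algebraMap F L ρ ≠ 0 := by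
      intro h
      apply ht
      rw [hqt, h]
      simp
    have hq₂t : Polynomial.aeval t q₂ ≠ 0 := by
      intro h
      apply ht
      rw [hqt, h, mul_zero]
    rw [hqt, hq₁t, hpt]
    field_simp
    ring

/-! ## The full expansion -/

/-- The degree-zero case: `q = a ≠ 0` constant, `p/q` is the polynomial `a⁻¹ p`. [folklore] -/
theorem exists_parfrac_field_of_natDegree_eq_zero {F L : Type*} [Field F] [Field L] [Algebra F L]
    (p q : F[X]) (hq : q ≠ 0) (hdeg : q.natDegree = 0) :
    ∃ (P : F[X]) (N : ℕ) (ρ : Fin N → F) (k : Fin N → ℕ) (c : Fin N → F),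
      (∀ i, q.IsRoot (ρ i)) ∧
      ∀ t : L, Polynomial.aeval t q ≠ 0 →
        Polynomial.aeval t p / Polynomial.aeval t q =
          Polynomial.aeval t P +
            ∑ i, algebraMap F L (c i) / (t - algebraMap F L (ρ i)) ^ (k i + 1) := by
  obtain ⟨a, rfl⟩ := Polynomial.natDegree_eq_zero.mp hdeg
  have ha : a ≠ 0 := by
    rintro rfl
    exact hq (by simp)
  refine ⟨Polynomial.C a⁻¹ * p, 0, Fin.elim0, Fin.elim0, Fin.elim0, fun i => Fin.elim0 i,
    fun t _ => ?_⟩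
  have hat : algebraMap F L a ≠ 0 := (map_ne_zero _).mpr ha
  simp only [Polynomial.aeval_C, map_mul, map_inv₀, Finset.univ_eq_empty, Finset.sum_empty,
    add_zero]
  field_simp

/-- **Partial fractions over a field, by peeling.** If `q ≠ 0` splits over the field `F` then
`p/q = P(t) + Σᵢ cᵢ/(t − ρᵢ)^{kᵢ+1}` at every `t` of a field extension `L` with `q(t) ≠ 0`, for
some `P ∈ F[X]` and finitely many `(ρᵢ, kᵢ, cᵢ) ∈ F × ℕ × F` with every `ρᵢ` a root of `q`
(repetitions allowed). Strong induction on `deg q` by `exists_peel_pole_field`. [folklore] -/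
theorem exists_parfrac_field {F L : Type*} [Field F] [Field L] [Algebra F L] :
    ∀ (n : ℕ) (p q : F[X]), q ≠ 0 → q.Splits → q.natDegree ≤ n →
      ∃ (P : F[X]) (N : ℕ) (ρ : Fin N → F) (k : Fin N → ℕ) (c : Fin N → F),
        (∀ i, q.IsRoot (ρ i)) ∧
        ∀ t : L, Polynomial.aeval t q ≠ 0 →
          Polynomial.aeval t p / Polynomial.aeval t q =
            Polynomial.aeval t P +
              ∑ i, algebraMap F L (c i) / (t - algebraMap F L (ρ i)) ^ (k i + 1)
  | 0, p, q, hq, _, hdeg =>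
    exists_parfrac_field_of_natDegree_eq_zero p q hq (Nat.le_zero.mp hdeg)
  | n + 1, p, q, hq, hsplit, hdeg => by
    by_cases h0 : q.natDegree = 0
    · exact exists_parfrac_field_of_natDegree_eq_zero p q hq h0
    -- a root, and one peeling step
    have hdeg0 : q.degree ≠ 0 := fun h => h0 (Polynomial.natDegree_eq_of_degree_eq_some h)
    obtain ⟨ρ, hρ⟩ := hsplit.exists_eval_eq_zero hdeg0
    obtain ⟨k, c, p₁, q₁, hq₁0, hq₁deg, hq₁dvd, hpeel⟩ :=
      exists_peel_pole_field (L := L) p q hq (ρ := ρ) hρ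
    -- the induction hypothesis for `p₁/q₁`
    obtain ⟨P, N, ρ', k', c', hroots, hP⟩ :=
      exists_parfrac_field (L := L) n p₁ q₁ hq₁0 (hsplit.of_dvd hq hq₁dvd) (by omega)
    refine ⟨P, N + 1, Fin.cons ρ ρ', Fin.cons k k', Fin.cons c c', fun i => ?_, fun t ht => ?_⟩
    · refine Fin.cases ?_ (fun j => ?_) i
      · simpa using hρ
      · simpa using (hroots j).dvd hq₁dvd
    · have hq₁t : Polynomial.aeval t q₁ ≠ 0 := by
        obtain ⟨w, hw⟩ := hq₁dvd
        intro h
        apply ht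
        rw [hw, map_mul, h, zero_mul]
      rw [hpeel t ht, hP t hq₁t, Fin.sum_univ_succ]
      simp only [Fin.cons_zero, Fin.cons_succ]
      ring

/-! ## Primitives of polynomials with coefficients in a field of characteristic zero -/

/-- Every `A ∈ F[X]` (`F` a field of characteristic `0` mapping to `ℝ`) has a primitive `G ∈ F[X]`
as a real function: `(aeval · G)' = aeval · A`. [folklore] -/
theorem exists_polynomial_primitive_field {K : Type*} [Field K] [CharZero K] [Algebra K ℝ]
    (A : K[X]) :
    ∃ G : K[X], ∀ t : ℝ, HasDerivAt (fun u : ℝ => Polynomial.aeval u G) (Polynomial.aeval t A) t := by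
  -- adapted from `Dlog.exists_polynomial_hasDerivAt` (…SplitAlgebra.lean), `ℚ` replaced by `K`
  suffices h : ∃ G : K[X], Polynomial.derivative G = A by
    obtain ⟨G, hG⟩ := h
    refine ⟨G, fun t => ?_⟩
    have := Polynomial.hasDerivAt_aeval G t
    rwa [hG] at this
  induction A using Polynomial.induction_on' with
  | add p q hp hq =>
    obtain ⟨Gp, hGp⟩ := hp
    obtain ⟨Gq, hGq⟩ := hq
    exact ⟨Gp + Gq, by rw [Polynomial.derivative_add, hGp, hGq]⟩
  | monomial n a =>
    refine ⟨Polynomial.C (a / ((n : K) + 1)) * Polynomial.X ^ (n + 1), ?_⟩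
    have hn : ((n : K) + 1) ≠ 0 := by exact_mod_cast Nat.succ_ne_zero n
    rw [Polynomial.derivative_C_mul_X_pow, ← Polynomial.C_mul_X_pow_eq_monomial,
      Nat.add_sub_cancel]
    congr 2
    push_cast
    exact div_mul_cancel₀ a hn

end Summit.KontsevichZagierPeriods.HurwitzMicroSectors.NormalFormPrinciple.PiBox.SiegeK6
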